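import Mathlib
import HarnessLib

/-!
# Magnen–Rivasseau–Sénéor, *Construction of YM₄ with an infrared cutoff* (CMP 155, 1993), §VII «The Convergence of the Expansion:
# Bounds on Error Terms» — the slice-propagator bound (VII.1) AS PRINTED and the printed power counting of p.375, kernel-checked

statement-level skeleton of published theorems with citation tags; proofs where landed; nothing here is a claim about the
Yang–Mills mass gap, about continuum YM₄ on T⁴, or about the Clay problem

**Citation header (reproduction of PUBLISHED work).** J. Magnen, V. Rivasseau, R. Sénéor, *Construction of YM₄ with an infrared
cutoff*, Commun. Math. Phys. **155** (1993) 325–383 [MagnenRivasseauSeneor1993], Sect. VII pp. 374–376. Loci «p.NNN [PDF nn] tl.k» =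
journal page, PDF page (= journal page − 324), text-layer line of the held Project-Euclid scan `paper:magnen1993-cmp155-mrs-ym4-infrared-cutoff`
(PDF sha256 fa4ddac3…); (VII.1) and the power-counting lines were read on the page image
`run/shared/lean/pub/lit-balaban/inprint/lit-balaban-p14/renders-cmp155/p51_full_s6.png`. Cell pub-balaban-gaps (YM blitz, track G3), seat
mrs-lit-2; companion record `run/shared/lean/pub/pub-balaban-gaps/g3/MRS-AS-PRINTED-estimates.md`.

**Grade of record (lit-balaban YM-INPRINT.md row D1).** Sect. VII: **SKETCH** — p.374 [PDF 50] tl.29 «In this section we summarize the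
reasons for convergence of our expansion» (2½ pages of power counting by reference to [R]; no theorem is stated). This file types the one
display, (VII.1), as a predicate and kernel-checks the exponent arithmetic the page prints; it upgrades nothing.

**What the paper prints (verbatim, p.375 [PDF 51]; display from the page image).**
* tl.8–13: «Let us consider the small field propagator in a slice of index j = {i, α}. From the point of view of power counting the
  homothetic gauge is similar to the Feynman gauge, hence to simplify notations let us pretend the small field propagator to be simply
  1/p². The same propagator in the slice j would then be C^j = κ^j(p)/p². It satisfies the estimate
  C^j(x − y) ≤ K_q M^i M^α (1/(1 + |x₀ − y₀|M^α) · 1/(1 + |x⃗ − y⃗|M^i))^q (VII.1) for some large integer q.»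
* tl.14–19: «The power counting of the worse vertex (which is a trilinear vertex with derivative coupling A²∂A rather than a quartic A⁴
  vertex) integrated in a box of 𝐃^j is M^i M^{(3/2)(i+α)} M^{−3i−α} = M^{−(i−α)/2}. This vertex is equipped with one factor λ. However by
  parity a single such vertex vanishes. Therefore we have at least two such vertices, which means the same power counting as a single
  quartic vertex (of power counting M^{2(i+α)}M^{−3i−α} = M^{−(i−α)}) with coupling λ².»
* tl.20–25: «Since the smallest value of the index α at i fixed is α_min such that M^{−(i−α_min)} ≤ λ^{−1} (see II.21a–b), we conclude
  that in the vertical expansion any contribution of scale α to attached to a box of scale α′, with α_min < α′ < α can be resummed in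
  the box of scale α′ (which contains M^{α−α′} boxes of scale α) using one coupling constant λ ≤ M^{−(α−α′)}; furthermore there remains
  a small factor of size at least λ. Finally there remains a factor at least M^{−(i−α)} which means that the sum over α can be performed
  and that in fact most of the sum comes from the case α = i.»
* tl.33–36: «in the case of five or more legs (t_Δ ≠ 0) power counting provides the necessary factor M^{−5|i−i′|} to resum a box of scale
  i among the M^{4|i−i′|} boxes of scale i contained in a box of scale i′.»
* tl.38–42: «the "proximity" links … extend only to a bounded distance, independent of λ. It is possible to resum over such links (which
  costs only a factor independent of λ) using a piece of the small factors O(e^{−λ^{−ε}}) associated to the large field regions (see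
  II.28).»

**What is typed / proved here (zero `sorry`; zero closed named facts).**
* §1 `SliceBound` / `IneqVII1Printed` — (VII.1) as a predicate on a sliced small-field kernel family `C i α (x − y)` (prefactor
  `K_q M^i M^α`; quantifiers `∀ q, ∃ K_q` as in (II.27), the literal «for some large integer q» being `IneqVII1Printed_exists`,
  implied by it (`ineqVII1_exists_of_forall`); see reading (ii)).
* §2 THE PRINTED EXPONENT ARITHMETIC for real `M > 0` and natural `i, α` (real exponents where `3/2` occurs): `trilinear_powerCounting`
  «M^i M^{(3/2)(i+α)} M^{−3i−α} = M^{−(i−α)/2}», `quartic_powerCounting` «M^{2(i+α)}M^{−3i−α} = M^{−(i−α)}», `two_trilinear_eq_quartic`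
  (two worst vertices = one quartic vertex: `(M^{−(i−α)/2})² = M^{−(i−α)}`), `resum_alpha` («M^{α−α′} boxes … using one coupling constant
  λ ≤ M^{−(α−α′)}»: `M^{α−α′}·λ ≤ 1`), `resum_vertical` («M^{−5|i−i′|}» against «M^{4|i−i′|} boxes» leaves `M^{−|i−i′|}`), and
  `vertical_sum_converges` — the leftover factors `M^{−k}`, `k = |i − i′| ≥ 0`, are summable with sum `M/(M − 1)` for `M > 1` (the sense in
  which «the sum … can be performed»).

**v1.1 (same seat, append-only; referee NIT [REF G3 v2] on `resum_alpha` + p.376).** `resum_alpha` keeps its ℕ-exponent `α − α′`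
(truncated subtraction: in the printed regime `α′ < α` it is the intended `M^{α−α′}`; for `α ≤ α′` it degenerates to `M⁰ = 1`, and the
statement stays true but says nothing) — now said here, and complemented by `resum_alpha_rpow` with the REAL exponent `(α : ℝ) − α′`
(no truncation). Plus p.376 [PDF 52] tl.31–40 (image `p52_full_s6.png`): «we can include all the boxes which contain it until frequency
i′ = i − K|log λ| in the protection corridor (K being a large constant) … if we dominate the A^{i′} field using the small field condition
we gain a small factor M^{−K|log λ|} which comes from writing M^{i′} ≤ M^i M^{−K|log λ|}. This factor is by itself a very large power of
λ» — `corridor_scale_eq` (`M^{i − K|log λ|} = M^i·M^{−K|log λ|}`, real exponents) and `largePower_eq` (`M^{−K|log λ|} = λ^{K log M}` for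
`0 < λ < 1`, `M > 0`: the «very large power of λ» has exponent `K log M`).

**Readings (declared).** (i) (VII.1) prints `C^j(x − y) ≤ …` for the (matrix-valued) kernel; typed on absolute values of scalar entries
(implies the printed one-sided bound). (ii) «for some large integer q» after the display is read, as in (II.27) («for any fixed large
integer q … K_q is some constant depending on q»), as: for every `q` there is a `K_q` — typed `∀ q, ∃ K_q`; the weaker literal `∃ q, K_q` is
`IneqVII1Printed_exists`, implied by it. (iii) `M` real `> 0` (an integer in the paper, p.335), slice indices natural numbers.

**What is NOT claimed.** (VII.1) itself (integration by parts on `κ^j(p)/p²`), the parity argument, the domination estimates of p.376,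
the Mayer-expansion convergence — none is formalised; Sect. VII states no theorem and none is manufactured here. Nothing here bears on
Bałaban's papers.
-/

noncomputable section

open Real

namespace Literature.MathematicalPhysics.QuantumFieldTheory.MagnenRivasseauSeneor1993

namespace Convergence

/-! ## §1 (VII.1) as a typed predicate -/

/-- **(VII.1)** for ONE `q` and ONE `K_q`: the sliced small-field propagator `C^j = κ^j(p)/p²`, `j = (i, α)`, as a kernel of
`x − y = (x₀ − y₀, x⃗ − y⃗) ∈ ℝ × ℝ³`, satisfies «`C^j(x − y) ≤ K_q M^i M^α (1/(1 + |x₀ − y₀|M^α) · 1/(1 + |x⃗ − y⃗|M^i))^q`» (typed on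
absolute values, reading (i)). [cite: MagnenRivasseauSeneor1993, §VII (VII.1) p.375] -/
def SliceBound (C : ℕ → ℕ → ℝ × EuclideanSpace ℝ (Fin 3) → ℝ) (M : ℝ) (q : ℕ) (Kq : ℝ) : Prop :=
  ∀ (i α : ℕ) (z : ℝ × EuclideanSpace ℝ (Fin 3)),
    |C i α z| ≤ Kq * M ^ i * M ^ α * (1 / (1 + |z.1| * M ^ α) * (1 / (1 + ‖z.2‖ * M ^ i))) ^ q

/-- **(VII.1)** p.375 [PDF 51] tl.8–13, verbatim: «The same propagator in the slice j would then be C^j = κ^j(p)/p². It satisfies the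
estimate `C^j(x − y) ≤ K_q M^i M^α (1/(1 + |x₀ − y₀|M^α) · 1/(1 + |x⃗ − y⃗|M^i))^q` (VII.1) for some large integer q.» Typed with the
(II.27) quantifiers `∀ q, ∃ K_q` (reading (ii)). GRADE OF RECORD: part of the Sect. VII SKETCH; a standard integration-by-parts estimate,
not proved here. [cite: MagnenRivasseauSeneor1993, §VII (VII.1) p.375] -/
def IneqVII1Printed (C : ℕ → ℕ → ℝ × EuclideanSpace ℝ (Fin 3) → ℝ) (M : ℝ) : Prop :=
  ∀ q : ℕ, ∃ Kq : ℝ, SliceBound C M q Kq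

/-- The literal «for some large integer q» form of (VII.1): `∃ q ≥ q₀, ∃ K_q`. [cite: MagnenRivasseauSeneor1993, §VII (VII.1) p.375] -/
def IneqVII1Printed_exists (C : ℕ → ℕ → ℝ × EuclideanSpace ℝ (Fin 3) → ℝ) (M : ℝ) (q₀ : ℕ) : Prop :=
  ∃ q : ℕ, q₀ ≤ q ∧ ∃ Kq : ℝ, SliceBound C M q Kq

/-- The `∀ q` form implies the literal «for some large q» form, for every threshold `q₀`.
[cite: MagnenRivasseauSeneor1993, §VII (VII.1) p.375] -/
theorem ineqVII1_exists_of_forall {C : ℕ → ℕ → ℝ × EuclideanSpace ℝ (Fin 3) → ℝ} {M : ℝ} (h : IneqVII1Printed C M)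
    (q₀ : ℕ) : IneqVII1Printed_exists C M q₀ :=
  ⟨q₀, le_rfl, h q₀⟩

/-! ## §2 The printed exponent arithmetic of p.375 -/

/-- p.375 tl.14–16, verbatim: «The power counting of the worse vertex (… a trilinear vertex with derivative coupling A²∂A …) integrated
in a box of 𝐃^j is `M^i M^{(3/2)(i+α)} M^{−3i−α} = M^{−(i−α)/2}`» — for real `M > 0` (real exponents).
[cite: MagnenRivasseauSeneor1993, §VII p.375] -/
theorem trilinear_powerCounting {M : ℝ} (hM : 0 < M) (i α : ℕ) :
    M ^ (i : ℝ) * M ^ ((3 / 2 : ℝ) * (i + α)) * M ^ (-(3 * (i : ℝ) + α)) = M ^ (-((i : ℝ) - α) / 2) := by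
  rw [← Real.rpow_add hM, ← Real.rpow_add hM]
  congr 1
  ring

/-- p.375 tl.18–19, verbatim: «a single quartic vertex (of power counting `M^{2(i+α)}M^{−3i−α} = M^{−(i−α)}`)».
[cite: MagnenRivasseauSeneor1993, §VII p.375] -/
theorem quartic_powerCounting {M : ℝ} (hM : 0 < M) (i α : ℕ) :
    M ^ (2 * ((i : ℝ) + α)) * M ^ (-(3 * (i : ℝ) + α)) = M ^ (-((i : ℝ) - α)) := by
  rw [← Real.rpow_add hM]
  congr 1
  ring

/-- p.375 tl.17–19: «Therefore we have at least two such vertices, which means the same power counting as a single quartic vertex» —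
`(M^{−(i−α)/2})² = M^{−(i−α)}`. [cite: MagnenRivasseauSeneor1993, §VII p.375] -/
theorem two_trilinear_eq_quartic {M : ℝ} (hM : 0 < M) (i α : ℕ) :
    (M ^ (-((i : ℝ) - α) / 2)) ^ 2 = M ^ (-((i : ℝ) - α)) := by
  rw [← Real.rpow_natCast, ← Real.rpow_mul hM.le]
  congr 1
  push_cast
  ring

/-- p.375 tl.21–24: «any contribution of scale α … can be resummed in the box of scale α′ (which contains `M^{α−α′}` boxes of scale α)
using one coupling constant `λ ≤ M^{−(α−α′)}`» — the count times the coupling is `≤ 1`. [cite: MagnenRivasseauSeneor1993, §VII p.375] -/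
theorem resum_alpha {M lam : ℝ} (hM : 0 < M) (α α' : ℕ)
    (hlam : lam ≤ (M ^ (α - α'))⁻¹) : (M ^ (α - α') : ℝ) * lam ≤ 1 := by
  have hpos : 0 < (M ^ (α - α') : ℝ) := by positivity
  calc (M ^ (α - α') : ℝ) * lam ≤ M ^ (α - α') * (M ^ (α - α'))⁻¹ := mul_le_mul_of_nonneg_left hlam hpos.le
    _ = 1 := mul_inv_cancel₀ hpos.ne'

/-- p.375 tl.33–36: «power counting provides the necessary factor `M^{−5|i−i′|}` to resum a box of scale i among the `M^{4|i−i′|}` boxes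
of scale i contained in a box of scale i′» — the product is `M^{−|i−i′|}`. [cite: MagnenRivasseauSeneor1993, §VII p.375] -/
theorem resum_vertical {M : ℝ} (hM : 0 < M) (i i' : ℤ) :
    M ^ (4 * |i - i'|) * M ^ (-(5 * |i - i'|)) = M ^ (-|i - i'|) := by
  rw [← zpow_add₀ hM.ne']
  congr 1
  ring

/-- «which means that the sum … can be performed» (p.375 tl.24–25, tl.33–36): the leftover factors `M^{−k}` over the scale
differences `k = |i − i′| = 0, 1, 2, …` are summable for `M > 1`, with `∑_k M^{−k} = M/(M − 1)` — a bound independent of the number of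
scales `ρ`. [cite: MagnenRivasseauSeneor1993, §VII p.375] -/
theorem vertical_sum_converges {M : ℝ} (hM : 1 < M) :
    HasSum (fun k : ℕ => (M ^ k)⁻¹) (M / (M - 1)) := by
  have h0 : 0 ≤ M⁻¹ := by positivity
  have h1 : M⁻¹ < 1 := inv_lt_one_of_one_lt₀ hM
  have h := hasSum_geometric_of_lt_one h0 h1
  have hM0 : M ≠ 0 := by positivity
  have hM1 : M - 1 ≠ 0 := sub_ne_zero.2 (ne_of_gt hM)
  convert h using 1
  · funext k
    rw [inv_pow]
  · field_simp

/-! ## v1.1 — the real-exponent form of the α-resummation, and the «very large power of λ» of p.376 -/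

/-- `resum_alpha` with a REAL exponent (no ℕ-truncation of `α − α′`): if `λ ≤ M^{−(α−α′)}` then `M^{α−α′}·λ ≤ 1`, for `M > 0` and
any real `α, α′` (p.375 tl.21–24 «M^{α−α′} boxes … using one coupling constant λ ≤ M^{−(α−α′)}»).
[cite: MagnenRivasseauSeneor1993, §VII p.375] -/
theorem resum_alpha_rpow {M lam α α' : ℝ} (hM : 0 < M) (hlam : lam ≤ M ^ (-(α - α'))) :
    M ^ (α - α') * lam ≤ 1 := by
  have hpos : 0 < M ^ (α - α') := Real.rpow_pos_of_pos hM _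
  calc M ^ (α - α') * lam ≤ M ^ (α - α') * M ^ (-(α - α')) := mul_le_mul_of_nonneg_left hlam hpos.le
    _ = 1 := by rw [← Real.rpow_add hM]; simp

/-- p.376 [PDF 52] tl.33–38: «until frequency i′ = i − K|log λ| … which comes from writing M^{i′} ≤ M^i M^{−K|log λ|}» — with
`i′ = i − K|log λ|` this is the identity `M^{i − K|log λ|} = M^i · M^{−K|log λ|}` (real exponents, `M > 0`).
[cite: MagnenRivasseauSeneor1993, §VII p.376] -/
theorem corridor_scale_eq {M K lam : ℝ} (hM : 0 < M) (i : ℝ) :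
    M ^ (i - K * |Real.log lam|) = M ^ i * M ^ (-(K * |Real.log lam|)) := by
  rw [← Real.rpow_add hM]
  ring_nf

/-- p.376 tl.38–40: «This factor [M^{−K|log λ|}] is by itself a very large power of λ» — precisely `M^{−K|log λ|} = λ^{K log M}` for
`0 < λ < 1` and `M > 0` (so for `M > 1` and `K` large the exponent `K log M` is large). [cite: MagnenRivasseauSeneor1993, §VII p.376] -/
theorem largePower_eq {M K lam : ℝ} (hM : 0 < M) (hlam0 : 0 < lam) (hlam1 : lam < 1) :
    M ^ (-(K * |Real.log lam|)) = lam ^ (K * Real.log M) := by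
  have hlog : |Real.log lam| = -Real.log lam := abs_of_neg (Real.log_neg hlam0 hlam1)
  rw [hlog, Real.rpow_def_of_pos hM, Real.rpow_def_of_pos hlam0]
  congr 1
  ring

end Convergence

end Literature.MathematicalPhysics.QuantumFieldTheory.MagnenRivasseauSeneor1993
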